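import Summits.ABC.StewartYu.ArchG3RecLinesClosed
import HarnessLib

/-!
# Cell abc-stewartyu, rung A1.L (crux r2 `ArchCoreRat`, stmt-ABC-20502), WP-L.A: the letter lines in closed form with a GENERIC adjugate
# letter `|C| ≤ κ·N` — `ArchG3Rec.LinesClosedK κ c` (plan R49: the factorial `(n−1)!` of `ArchG3RecLinesClosed` is not n-uniform;
# the path bound gives `κ = 2^{n−1}`, derived from the v5 shape letters in `ArchG3LinesAtomsC`)

`Summits/ABC/StewartYu/ArchG3RecLinesClosedK.lean` — cell `abc-stewartyu` (HOME `run/shared/lean/pub/abc-stewartyu/`; seat p5 g9 writes the TEXT,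
seat p1 proves `linesClosedK_holds … : P.LinesClosedK (2^(n−1)) c`).  Plain definitions on `ArchG3Rec n`; the texts of `ArchG3RecLinesClosed`
VERBATIM with the factorial `(n−1)!` replaced by the parameter `κ : ℕ` in the θ-box majorant `sRRK κ k = κ·Σ_{j>k}(2Bv j+1) + (2Bv k+1) + 2`
and in `btRK κ k = κ·N·B·Alast·Σ_{j>k} 1/Aⱼ + N·B·Alast/Aₖ`, propagated to `LbRK`, `ΓRK`, `yRK`, `CRK`, `YRK`, `logAmaxRRK`, `cPRK`, `cbRK`
and the line predicates `KStepLinesK`, `OddStepLinesK`, `HalfStepLinesK`, **`LinesClosedK κ c`**; the κ-free letters (`jl`, `Bexp`, `Alast`,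
`SAR`, `AθR`, `AθsumR`, `LνRR`, `cUR`, `cHR`, `U0`, `δR`, `cDR`) are those of `ArchG3RecLinesClosed`.  `ArchG3LinesAssemblyK` (p5) proves
`(∀ n ≥ 2, ∀ P, P.LinesClosedK (2^(n−1)) c) → ArchG3Line.LinesSupplyS c`.

WHAT THIS IS NOT: no inequality is proved here; no START; no crux moves.

## References
* Yu. V. Nesterenko, LNM 1819 (2003) — §4.2 (4.24)–(4.35), §4.3 (4.36)–(4.51), p. 87–95. [Nesterenko2003]
-/

noncomputable section

open Finset
open scoped Nat
open Summit.ABC.StewartYu.ArchSupply (WC)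
open Summit.ABC.StewartYu.ArchG3Setup (DΔC)

namespace Summit.ABC.StewartYu

namespace ArchG3Rec

open ArchG3Par (G)

variable {n : ℕ} (P : ArchG3Rec n)

/-! ### Boxes -/

/-- θ-radius majorant `sRRK κ k = κ·Σ_{j>k}(2Bv j+1) + (2Bv k+1) + 2 ≥ sθR F P k` (when `|C| ≤ κ·N`). [cite: Nesterenko2003, §3.5 (3.25); shape only] -/
def sRRK (κ : ℕ) (k : Fin n) : ℕ := κ * ∑ j ∈ Ioi k, (2 * P.Bv j + 1) + (2 * P.Bv k + 1) + 2

/-- θ-box majorant `LbRK lev k = (2·sRRK k)/2^lev ≥ Lb (sθR F P) lev k`. [cite: Nesterenko2003, §4 (4.1), §4.3 (4.48); shape only] -/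
def LbRK (κ : ℕ) (lev : ℕ) (k : Fin n) : ℕ := (2 * P.sRRK κ k) / 2 ^ lev

/-- `btRK κ k = κ·N·B·Alast·Σ_{j>k} 1/Aⱼ + N·B·Alast/Aₖ ≥ |b̃ₖ| = |Σ_{j≥k} bⱼ·Cⱼₖ|` (when `|C| ≤ κ·N`). [folklore] -/
def btRK (κ : ℕ) (k : Fin n) : ℝ := (κ : ℝ) * P.N * P.Bexp * P.Alast * ∑ j ∈ Ioi k, 1 / P.A j + P.N * P.Bexp * P.Alast / P.A k

/-! ### The two directional atoms -/

/-- jets box majorant `ΓRK lev k = LbRK lev k + 2·btRK k·((2Bv last+1)/N + 2) ≥ GammaC (Lb lev) k`. [cite: Nesterenko2003, §4.2 (4.22); shape only] -/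
def ΓRK (κ : ℕ) (lev : ℕ) (k : Fin n) : ℝ := (P.LbRK κ lev k : ℝ) + 2 * P.btRK κ k * ((2 * P.Bv P.jl + 1 : ℝ) / P.N + 2)

/-- jets scalar majorant `yRK lev = Σₖ AθR k·ΓRK lev k ≥ Σₖ Aₖ·Γₖ`. [cite: Nesterenko2003, §4.2 Lemma 4.3; shape only] -/
def yRK (κ : ℕ) (lev : ℕ) : ℝ := ∑ k, P.AθR k * P.ΓRK κ lev k

/-- the Cauchy radius of the jets line: `CRK lev = max 1 (yRK lev / T lev)`. [folklore] -/
def CRK (κ : ℕ) (lev : ℕ) : ℝ := max 1 (P.yRK κ lev / P.T lev)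

/-- Δ-weight ceiling majorant `YRK lev = Σₖ (B·N·LbRK lev k + 2·btRK k·(2Bv last + 3)) ≥ YC 1 0 (Lb lev)`. [cite: Nesterenko2003, §3.5 (3.36); shape only] -/
def YRK (κ : ℕ) (lev : ℕ) : ℝ := ∑ k, (P.Bexp * P.N * (P.LbRK κ lev k : ℝ) + 2 * P.btRK κ k * (2 * P.Bv P.jl + 3 : ℝ))

/-! ### Globals -/

/-- `logAmaxRRK` — the right-hand side of lp-1's `log_AmaxR_le` at `(c, e) = (1, 0)`, `V = A`, with `YC 1 0 (2·sθR) ≤ YRK 0`.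
[cite: Nesterenko2003, §3.5 (3.37), Prop. 3.9; shape only] -/
def logAmaxRRK (κ : ℕ) : ℝ :=
  (P.Tf 0 0 : ℝ) * (1 + Real.log (1 + P.YRK κ 0 / (P.Tf 0 0 : ℕ))) +
  (Real.log 2 + 23 / 20 * (P.Tf 0 0) * P.H +
    (((P.Sd * P.Tf 0 0 : ℕ) : ℝ) * Real.log 2 + P.H / Real.exp 1 + P.L₀ * (1 + Real.log (1 + (2 : ℝ) ^ P.Sd * (P.Nf 0 0 : ℝ) / P.H)))) +
  (2 * (P.Nf 0 0 : ℝ) * ∑ j, ((P.LνRR 0 j : ℝ) / P.N) * P.A j + 2 * ∑ j, P.A j) +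
  P.wl 0 * (P.Nf 0 0 : ℕ)

/-- `cPRK = log 2 + cUR + logAmaxRRK ≥ log ⌈#unkA·AmaxR⌉`. [folklore] -/
def cPRK (κ : ℕ) : ℝ := Real.log 2 + P.cUR + P.logAmaxRRK κ

/-- box ceiling `cbRK c lev m = log 2 + log(LbRK lev last + 1) + log(m+1) − U0 c` (`2·LbRK·δ₀·m ≤ exp cbRK`). [folklore] -/
def cbRK (κ : ℕ) (c : ℝ) (lev m : ℕ) : ℝ := Real.log 2 + Real.log (P.LbRK κ lev P.jl + 1 : ℝ) + Real.log (m + 1 : ℝ) - P.U0 c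

/-! ### One step's closed lines -/

/-- **Closed k-step lines at `(lev, ν) → (lev, ν+1)`** (text of ✓ `KStepLinesV` with the record schedule and the closed atoms; `y/C ↦ t`).
[cite: Nesterenko2003, §4.2 (4.24)–(4.35), p. 87–90; shape only] -/
def KStepLinesK (κ : ℕ) (c : ℝ) (lev ν : ℕ) : Prop :=
  1 ≤ P.T lev ∧ P.Tf lev (ν + 1) + P.T lev ≤ P.Tf lev ν ∧ P.Nf lev (ν + 1) ≤ 3 * P.Nf lev ν + 2 ∧
  (P.LbRK κ lev P.jl : ℝ) * P.δR c * (3 * P.Nf lev ν + 2) ≤ 1 ∧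
  (∀ (x₁ : ℤ) (a : ℕ), |x₁| ≤ (P.Nf lev (ν + 1) : ℤ) → a < P.Tf lev (ν + 1) →
    P.γb lev * P.Nf lev (ν + 1) +
      Real.log (2 * ((2 * P.Nf lev ν + 1 : ℕ) : ℝ) ^ (P.T lev + 1) * P.T lev * (20 * Real.exp 1) ^ ((2 * P.Nf lev ν + 1) * P.T lev)) +
      P.T lev * Real.log (2 * P.CRK κ lev) + P.γb lev * (P.Nf lev ν + 1) + a * Real.log 2 + P.T lev + P.cUR + P.cPRK κ +
      Real.log (DΔC (P.YRK κ lev) (P.Tf lev (ν + 1))) + Real.log (WC P.H (P.Sd - lev) P.L₀ (P.Tf lev ν) (3 * P.Nf lev ν + 2)) +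
      (P.γb lev + P.wl lev) * P.Nf lev ν + P.cbRK κ c lev (P.Nf lev ν) + P.cDR lev a |(x₁ : ℝ)| + Real.log 3 ≤ 0) ∧
  (∀ (x₁ : ℤ) (a : ℕ), |x₁| ≤ (P.Nf lev (ν + 1) : ℤ) → a < P.Tf lev (ν + 1) →
    P.γb lev * P.Nf lev (ν + 1) + P.cUR + P.cPRK κ + Real.log (DΔC (P.YRK κ lev) (P.Tf lev (ν + 1))) +
      Real.log (WC P.H (P.Sd - lev) P.L₀ (P.Tf lev (ν + 1)) ((3 * Real.exp (G n) + 1) * (2 * P.Nf lev ν + 1) + P.Nf lev ν)) +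
      (P.wl lev + (P.LbRK κ lev P.jl : ℝ) * P.δR c) * ((3 * Real.exp (G n) + 1) * (2 * P.Nf lev ν + 1) + P.Nf lev ν) -
      (((2 * P.Nf lev ν + 1) * P.T lev : ℕ) : ℝ) * G n + P.cDR lev a |(x₁ : ℝ)| + Real.log 3 ≤ 0) ∧
  (∀ (x₁ : ℤ) (a : ℕ), |x₁| ≤ (P.Nf lev (ν + 1) : ℤ) → a < P.Tf lev (ν + 1) →
    P.cUR + P.cPRK κ + Real.log (DΔC (P.YRK κ lev) (P.Tf lev (ν + 1))) + Real.log (WC P.H (P.Sd - lev) P.L₀ (P.Tf lev ν) (3 * P.Nf lev ν + 2)) +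
      (P.γb lev + P.wl lev) * P.Nf lev (ν + 1) + P.cbRK κ c lev (P.Nf lev (ν + 1)) + P.cDR lev a |(x₁ : ℝ)| + Real.log 3 < 0)

/-- **Closed odd-node k-step lines at `(lev, 0) → (lev, 1)`** (`lev ≥ 1`; `m := Nh lev = Xs lev`; text of ✓ `OddStepLinesV`).
[cite: Nesterenko2003, §4.2 with the nodes 𝒳_{s,0}, p. 87–90; shape only] -/
def OddStepLinesK (κ : ℕ) (c : ℝ) (lev : ℕ) : Prop :=
  1 ≤ P.Nh lev ∧ 1 ≤ P.T lev ∧ P.Tf lev 1 + P.T lev ≤ P.Tf lev 0 ∧ P.Nf lev 1 ≤ 6 * P.Nh lev ∧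
  (P.LbRK κ lev P.jl : ℝ) * P.δR c * (6 * P.Nh lev) ≤ 1 ∧
  (∀ (x₁ : ℤ) (a : ℕ), |x₁| ≤ (P.Nf lev 1 : ℤ) → a < P.Tf lev 1 →
    P.γb lev * P.Nf lev 1 +
      Real.log (2 * ((2 * P.Nh lev : ℕ) : ℝ) ^ (P.T lev + 1) * P.T lev * (20 * Real.exp 1) ^ ((2 * P.Nh lev) * P.T lev)) +
      P.T lev * Real.log 2 + P.T lev * Real.log (2 * P.CRK κ lev) + P.γb lev * (2 * P.Nh lev) + a * Real.log 2 + P.T lev + P.cUR + P.cPRK κ +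
      Real.log (DΔC (P.YRK κ lev) (P.Tf lev 1)) + Real.log (WC P.H (P.Sd - lev) P.L₀ (P.Tf lev 0) (6 * P.Nh lev)) +
      (P.γb lev + P.wl lev) * ((2 * P.Nh lev - 1 : ℕ) : ℝ) + P.cbRK κ c lev (2 * P.Nh lev - 1) + P.cDR lev a |(x₁ : ℝ)| + Real.log 3 ≤ 0) ∧
  (∀ (x₁ : ℤ) (a : ℕ), |x₁| ≤ (P.Nf lev 1 : ℤ) → a < P.Tf lev 1 →
    P.γb lev * P.Nf lev 1 + P.cUR + P.cPRK κ + Real.log (DΔC (P.YRK κ lev) (P.Tf lev 1)) +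
      Real.log (WC P.H (P.Sd - lev) P.L₀ (P.Tf lev 1) ((12 * Real.exp (G n) + 6) * P.Nh lev)) +
      (P.wl lev + (P.LbRK κ lev P.jl : ℝ) * P.δR c) * ((12 * Real.exp (G n) + 6) * P.Nh lev) -
      (((2 * P.Nh lev) * P.T lev : ℕ) : ℝ) * G n + P.cDR lev a |(x₁ : ℝ)| + Real.log 3 ≤ 0) ∧
  (∀ (x₁ : ℤ) (a : ℕ), |x₁| ≤ (P.Nf lev 1 : ℤ) → a < P.Tf lev 1 →
    P.cUR + P.cPRK κ + Real.log (DΔC (P.YRK κ lev) (P.Tf lev 1)) + Real.log (WC P.H (P.Sd - lev) P.L₀ (P.Tf lev 0) (6 * P.Nh lev)) +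
      (P.γb lev + P.wl lev) * P.Nf lev 1 + P.cbRK κ c lev (P.Nf lev 1) + P.cDR lev a |(x₁ : ℝ)| + Real.log 3 < 0)

/-- **Closed half-step lines at `(lev, n) → (lev+1, 0)`** (`ex := Ŝ − (lev+1)`, `N := Nf lev n`, `N₁ := Nh (lev+1)`; text of ✓ `HalfStepLinesV`
with the threshold exponent `Θ = 2ⁿ·(log 4 + cDh + (log 2 + cUR + cPRK + log DΔC + log MtV) + 2·cHR)`, `log MtV = log WC(H, ex+1, L₀, T′, N₁) +
(γb+w)·N₁ + AθsumR/2`, `Σ(colU/N)·A ↦ n·SAR`). [cite: Nesterenko2003, §4.3 (4.36)–(4.51), p. 90–95; shape only] -/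
def HalfStepLinesK (κ : ℕ) (c : ℝ) (lev : ℕ) : Prop :=
  1 ≤ P.T lev ∧ P.Tf (lev + 1) 0 + P.T lev ≤ P.Tf lev n ∧ 2 * P.Nh (lev + 1) ≤ 6 * P.Nf lev n + 5 ∧
  (P.LbRK κ lev P.jl : ℝ) * P.δR c * (3 * P.Nf lev n + 2) ≤ 1 ∧
  (∀ (s : ℤ) (a : ℕ), Odd s → |s| ≤ 2 * (P.Nh (lev + 1) : ℤ) - 1 → a < P.Tf (lev + 1) 0 →
    P.γb lev * (3 * P.Nf lev n + 2) +
      Real.log (2 * ((2 * P.Nf lev n + 1 : ℕ) : ℝ) ^ (P.T lev + 1) * P.T lev * (20 * Real.exp 1) ^ ((2 * P.Nf lev n + 1) * P.T lev)) +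
      P.T lev * Real.log (2 * P.CRK κ lev) + P.γb lev * (P.Nf lev n + 1) + a * Real.log 2 + P.T lev + P.cUR + P.cPRK κ +
      Real.log (DΔC (P.YRK κ lev) (P.Tf (lev + 1) 0)) + Real.log (WC P.H (P.Sd - (lev + 1) + 1) P.L₀ (P.Tf lev n) (P.Nf lev n)) +
      (P.γb lev + P.wl lev) * P.Nf lev n + P.cbRK κ c lev (P.Nf lev n) +
      (2 : ℝ) ^ n * (Real.log 4 + (23 / 20 * a * P.H + (|(s : ℝ)| * ∑ j, ((P.LνRR lev j : ℝ) / P.N) * P.A j + n * P.SAR + 2 * P.SAR)) +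
        (Real.log 2 + P.cUR + P.cPRK κ + Real.log (DΔC (P.YRK κ lev) (P.Tf (lev + 1) 0)) +
          (Real.log (WC P.H (P.Sd - (lev + 1) + 1) P.L₀ (P.Tf (lev + 1) 0) (P.Nh (lev + 1))) + (P.γb lev + P.wl lev) * P.Nh (lev + 1) +
            P.AθsumR / 2)) + 2 * P.cHR) +
      Real.log 3 ≤ 0) ∧
  (∀ (s : ℤ) (a : ℕ), Odd s → |s| ≤ 2 * (P.Nh (lev + 1) : ℤ) - 1 → a < P.Tf (lev + 1) 0 →
    P.γb lev * (3 * P.Nf lev n + 2) + P.cUR + P.cPRK κ + Real.log (DΔC (P.YRK κ lev) (P.Tf (lev + 1) 0)) +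
      Real.log (WC P.H (P.Sd - (lev + 1) + 1) P.L₀ (P.Tf (lev + 1) 0) ((3 * Real.exp (G n) + 1) * (2 * P.Nf lev n + 1) + P.Nf lev n)) +
      (P.wl lev + (P.LbRK κ lev P.jl : ℝ) * P.δR c) * ((3 * Real.exp (G n) + 1) * (2 * P.Nf lev n + 1) + P.Nf lev n) -
      (((2 * P.Nf lev n + 1) * P.T lev : ℕ) : ℝ) * G n +
      (2 : ℝ) ^ n * (Real.log 4 + (23 / 20 * a * P.H + (|(s : ℝ)| * ∑ j, ((P.LνRR lev j : ℝ) / P.N) * P.A j + n * P.SAR + 2 * P.SAR)) +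
        (Real.log 2 + P.cUR + P.cPRK κ + Real.log (DΔC (P.YRK κ lev) (P.Tf (lev + 1) 0)) +
          (Real.log (WC P.H (P.Sd - (lev + 1) + 1) P.L₀ (P.Tf (lev + 1) 0) (P.Nh (lev + 1))) + (P.γb lev + P.wl lev) * P.Nh (lev + 1) +
            P.AθsumR / 2)) + 2 * P.cHR) +
      Real.log 3 ≤ 0) ∧
  (∀ (s : ℤ) (a : ℕ), Odd s → |s| ≤ 2 * (P.Nh (lev + 1) : ℤ) - 1 → a < P.Tf (lev + 1) 0 →
    P.cUR + P.cPRK κ + Real.log (DΔC (P.YRK κ lev) (P.Tf (lev + 1) 0)) + Real.log (WC P.H (P.Sd - (lev + 1) + 1) P.L₀ (P.Tf (lev + 1) 0) (P.Nh (lev + 1))) +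
      (P.γb lev + P.wl lev) * (3 * P.Nf lev n + 2) + P.cbRK κ c lev (3 * P.Nf lev n + 2) +
      (2 : ℝ) ^ n * (Real.log 4 + (23 / 20 * a * P.H + (|(s : ℝ)| * ∑ j, ((P.LνRR lev j : ℝ) / P.N) * P.A j + n * P.SAR + 2 * P.SAR)) +
        (Real.log 2 + P.cUR + P.cPRK κ + Real.log (DΔC (P.YRK κ lev) (P.Tf (lev + 1) 0)) +
          (Real.log (WC P.H (P.Sd - (lev + 1) + 1) P.L₀ (P.Tf (lev + 1) 0) (P.Nh (lev + 1))) + (P.γb lev + P.wl lev) * P.Nh (lev + 1) +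
            P.AθsumR / 2)) + 2 * P.cHR) +
      Real.log 3 < 0)

/-! ### All levels -/

/-- **THE LETTER LINES IN CLOSED FORM** at the constant `c` (level-wise exactly as `ArchLinesHoldV`/`ArchPacksHoldV`: level `0`:
`KStepLinesK` at `(0, ν)`, `ν < n`; for every `lev < Ŝ`: `HalfStepLinesK` at `lev`, `OddStepLinesK` at `lev+1`, `KStepLinesK` at `(lev+1, ν)`,
`1 ≤ ν < n`).  Record-side content of `stub_recLinesArch`; proved by seat p1 (`linesClosedK_holds`, κ := 2^(n−1)). [cite: Nesterenko2003, §4 Prop. 4.1, §4.2–4.3,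
p. 80–95; shape only] -/
def LinesClosedK (κ : ℕ) (c : ℝ) : Prop :=
  (∀ ν, ν < n → P.KStepLinesK κ c 0 ν) ∧
  (∀ lev < P.Sd, P.HalfStepLinesK κ c lev) ∧
  (∀ lev < P.Sd, P.OddStepLinesK κ c (lev + 1)) ∧
  (∀ lev < P.Sd, ∀ ν, 1 ≤ ν → ν < n → P.KStepLinesK κ c (lev + 1) ν)

end ArchG3Rec

end Summit.ABC.StewartYu

end
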